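import Summits.ResolutionOfSingularities.ResolutionOfSingularities.Theorems.FrobeniusLadderFInjectiveMacaulayficationF108ToricPoly

/-!
# [OURS · L1 W4.5a · F-108 toric infrastructure, relative step] Sum sets, the `B`-shifted state, the product formula for two exponent sets

Support file toward ★ `MonomialFloorClassRow.F108ConsumableRel_holds` (the RELATIVE open-obligation node of ✓ p685336: an arbitrary
`𝔪`-primary monomial floor `(x^B)` in place of the point floor), on res-L1-toric-fan g0's edge-star engine (✓ `…F108ToricCones/Star/StarSC/
Stage/Build/MW/Tables/Poly`); seat res-L1-toric-fan g2.  Three finitary observations, no new geometry: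

* pointwise sums `E + B = {e + b}`: a cone good for `E + B` is good for `E` and for `B` (`good_left_of_add`, `good_right_of_add`) — the
  normal fan of `N(E) + N(B)` refines both Newton fans;
* the shift `d ↦ (rays_d, β rays_d + m_d, w_d, l_d)` and ★ `inv_image_shift`: if `β` assigns to every cone of a state a `B`-MINIMISER of its
  rays (`B ⊆ ℕⁿ` with a pure power of every variable), the shifted cones satisfy the WHOLE invariant bundle `Inv` again (strict concavity,
  `𝔪`-domination, neighbour membership, boundary vanishing are monotone under adding the support function of `B`, which is linear on every
  cone and zero on boundary rays) — so ✓ `Inv.mw_int` (ray-shooting Minkowski–Weyl) applies verbatim to the polyhedron `N(B) + P_h`;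
* `span_image_add`: `(x^{β + κ} : β ∈ B, κ ∈ K) = (x^β : β ∈ B) · (x^κ : κ ∈ K)`.
AI-written; weaker than expert review. Nothing here proves resolution of singularities in positive characteristic.
-/

set_option linter.dupNamespace false

noncomputable section

namespace Summit.ResolutionOfSingularities.ResolutionOfSingularities.Theorems.FInjectiveMacaulayfication.F108Toric

open Matrix Finset MvPolynomial

variable {n : ℕ}

/-! ## The pointwise sum of two exponent sets and goodness -/

open Pointwise in
/-- A cone good for the pointwise sum `E + B` is good for `E` (the common minimiser `e₀ + b₀` yields the common minimiser `e₀`):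
the normal fan of `N(E) + N(B)` refines the Newton fan of `E`. -/
theorem good_left_of_add {E B : Finset (Fin n → ℤ)} {d : DCone n} (hg : Good (E + B) d) : Good E d := by
  obtain ⟨c, hc, hmin⟩ := hg
  obtain ⟨e₀, he₀, b₀, hb₀, rfl⟩ := Finset.mem_add.1 hc
  refine ⟨e₀, he₀, fun i e he => ?_⟩
  have h := hmin i (e + b₀) (Finset.add_mem_add he hb₀)
  rw [dotProduct_add, dotProduct_add] at h
  linarith

open Pointwise in
/-- A cone good for the pointwise sum `E + B` is good for `B`. -/
theorem good_right_of_add {E B : Finset (Fin n → ℤ)} {d : DCone n} (hg : Good (E + B) d) : Good B d := by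
  obtain ⟨c, hc, hmin⟩ := hg
  obtain ⟨e₀, he₀, b₀, hb₀, rfl⟩ := Finset.mem_add.1 hc
  refine ⟨b₀, hb₀, fun i b hb => ?_⟩
  have h := hmin i (e₀ + b) (Finset.add_mem_add he₀ hb)
  rw [dotProduct_add, dotProduct_add] at h
  linarith

/-! ## Shifting the vertices of a state by the `B`-minimisers of its cones -/

/-- Membership in the shifted state `{(rays_d, β rays_d + m_d, w_d, l_d) : d ∈ S}`. -/
theorem mem_image_shift {β : (Fin n → Fin n → ℤ) → (Fin n → ℤ)} {S : Finset (DCone n)} {d' : DCone n} :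
    d' ∈ S.image (fun d : DCone n => (⟨d.ray, β d.ray + d.m, d.w, d.l⟩ : DCone n)) ↔
      ∃ d ∈ S, d' = ⟨d.ray, β d.ray + d.m, d.w, d.l⟩ := by
  simp only [mem_image]
  exact exists_congr fun d => and_congr_right fun _ => eq_comm

/-- Goodness is a property of the rays, hence survives the shift. -/
theorem good_shift {𝒜 : Finset (Fin n → ℤ)} {β : (Fin n → Fin n → ℤ) → (Fin n → ℤ)} {d : DCone n} (hg : Good 𝒜 d) :
    Good 𝒜 ⟨d.ray, β d.ray + d.m, d.w, d.l⟩ := by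
  obtain ⟨b, hb, h⟩ := hg
  exact ⟨b, hb, h⟩

/-- ★ THE SHIFTED STATE IS A STATE: if `β d.ray ∈ B` minimises every ray of `d` over `B` (for every cone `d` of a state `S`), `B ⊆ ℕⁿ`
contains a pure power of every variable, then `{(rays_d, β_d + m_d, w_d, l_d)}` satisfies the whole invariant bundle again — the support
function of `B` is concave, linear on every cone and zero on boundary rays, so strict concavity, `𝔪`-domination, neighbour membership and
boundary vanishing are inherited. [OURS · the relative step] -/
theorem inv_image_shift {S : Finset (DCone n)} (hS : Inv S) (β : (Fin n → Fin n → ℤ) → (Fin n → ℤ)) (Bz : Finset (Fin n → ℤ))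
    (hBz0 : ∀ b ∈ Bz, ∀ j, 0 ≤ b j) (hBzpp : ∀ j : Fin n, ∃ c : ℤ, c • (Pi.single j 1 : Fin n → ℤ) ∈ Bz)
    (hβ : ∀ d ∈ S, β d.ray ∈ Bz ∧ ∀ i, ∀ b' ∈ Bz, d.ray i ⬝ᵥ β d.ray ≤ d.ray i ⬝ᵥ b') :
    Inv (S.image (fun d : DCone n => (⟨d.ray, β d.ray + d.m, d.w, d.l⟩ : DCone n))) := by
  classical
  -- the `B`-gap is nonnegative, and zero exactly on shared rays
  have hgap : ∀ d ∈ S, ∀ d' ∈ S, ∀ i, 0 ≤ d.ray i ⬝ᵥ (β d'.ray - β d.ray) := by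
    intro d hd d' hd' i
    rw [dotProduct_sub, sub_nonneg]
    exact (hβ d hd).2 i _ (hβ d' hd').1
  have hgap0 : ∀ d ∈ S, ∀ d' ∈ S, ∀ i, d.ray i ∈ d'.rays → d.ray i ⬝ᵥ (β d'.ray - β d.ray) = 0 := by
    intro d hd d' hd' i hmem
    obtain ⟨j, hj⟩ := mem_rays.1 hmem
    refine le_antisymm ?_ (hgap d hd d' hd' i)
    rw [dotProduct_sub, sub_nonpos, ← hj]
    exact (hβ d' hd').2 j _ (hβ d hd).1
  refine
    { nonneg := ?_, stdOrPos := ?_, dual := ?_, lmin := ?_, bdry := ?_, mnonneg := ?_, mlpos := ?_, sc := ?_, dom := ?_,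
      amem := ?_, complete := ?_ }
  · intro d' hd' i j; obtain ⟨d, hd, rfl⟩ := mem_image_shift.1 hd'; exact hS.nonneg d hd i j
  · intro d' hd' i; obtain ⟨d, hd, rfl⟩ := mem_image_shift.1 hd'; exact hS.stdOrPos d hd i
  · intro d' hd' i j; obtain ⟨d, hd, rfl⟩ := mem_image_shift.1 hd'; exact hS.dual d hd i j
  · intro d' hd' i j; obtain ⟨d, hd, rfl⟩ := mem_image_shift.1 hd'; exact hS.lmin d hd i j
  · intro d' hd' i hz; obtain ⟨d, hd, rfl⟩ := mem_image_shift.1 hd'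
    dsimp only at hz ⊢
    rw [dotProduct_add, hS.bdry d hd i hz, add_zero]
    -- the ray is a coordinate vector `e_s`; a pure power of another variable kills the minimum
    obtain ⟨j₀, hj₀⟩ := hz
    rcases hS.stdOrPos d hd i with ⟨s, hs⟩ | hpos
    · have hsj : s ≠ j₀ := by intro h; rw [hs, h] at hj₀; simp at hj₀
      obtain ⟨c, hc⟩ := hBzpp j₀
      refine le_antisymm ?_ ?_
      · have h := (hβ d hd).2 i _ hc
        rw [hs, single_dotProduct, one_mul, single_dotProduct, one_mul, Pi.smul_apply, Pi.single_apply, if_neg hsj,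
          smul_zero] at h
        rw [hs, single_dotProduct, one_mul]; exact h
      · rw [hs, single_dotProduct, one_mul]; exact hBz0 _ (hβ d hd).1 s
    · exfalso; have := hpos j₀; omega
  · intro d' hd' j; obtain ⟨d, hd, rfl⟩ := mem_image_shift.1 hd'
    simp only [Pi.add_apply]
    exact add_nonneg (hBz0 _ (hβ d hd).1 j) (hS.mnonneg d hd j)
  · intro d' hd'; obtain ⟨d, hd, rfl⟩ := mem_image_shift.1 hd'
    simp only [Pi.add_apply]
    have := hBz0 _ (hβ d hd).1 d.l; have := hS.mlpos d hd; omega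
  · intro c hc c' hc' i; obtain ⟨d, hd, rfl⟩ := mem_image_shift.1 hc; obtain ⟨d', hd', rfl⟩ := mem_image_shift.1 hc'
    dsimp only
    rw [show β d'.ray + d'.m - (β d.ray + d.m) = (β d'.ray - β d.ray) + (d'.m - d.m) by abel, dotProduct_add]
    constructor
    · intro h0
      have h1 := hgap d hd d' hd' i; have h2 := hS.sc_nonneg hd hd' i
      exact (hS.sc d hd d' hd' i).1 (by linarith)
    · intro hmem; rw [hgap0 d hd d' hd' i hmem, (hS.sc d hd d' hd' i).2 hmem, add_zero]
  · intro c hc c' hc' i; obtain ⟨d, hd, rfl⟩ := mem_image_shift.1 hc; obtain ⟨d', hd', rfl⟩ := mem_image_shift.1 hc'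
    dsimp only
    rw [show β d'.ray + d'.m - (β d.ray + d.m) = (β d'.ray - β d.ray) + (d'.m - d.m) by abel, dotProduct_add]
    have h1 := hgap d hd d' hd' i; have h2 := hS.dom d hd d' hd' i; linarith
  · intro c hc i; obtain ⟨d, hd, rfl⟩ := mem_image_shift.1 hc
    dsimp only
    rcases hS.amem d hd i with h1 | h2
    · left; intro c'' hc'' j; obtain ⟨d'', hd'', rfl⟩ := mem_image_shift.1 hc''
      dsimp only
      have h := h1 d'' hd'' j
      have hg := hgap d'' hd'' d hd j
      rw [show β d.ray + d.m + d.w i - (β d''.ray + d''.m) = (β d.ray - β d''.ray) + (d.m + d.w i - d''.m) by abel,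
        dotProduct_add]
      linarith
    · exact Or.inr h2
  · intro x hx; obtain ⟨d, hd, c, hc, hx'⟩ := hS.complete x hx
    exact ⟨⟨d.ray, β d.ray + d.m, d.w, d.l⟩, mem_image_of_mem (fun d : DCone n => (⟨d.ray, β d.ray + d.m, d.w, d.l⟩ : DCone n)) hd, c, hc, hx'⟩

/-! ## Exponent bookkeeping -/

/-- `ofN (single j N) = N • e_j`. -/
theorem ofN_single (j : Fin n) (N : ℕ) : ofN (Finsupp.single j N) = (N : ℤ) • (Pi.single j 1 : Fin n → ℤ) := by
  funext i; simp only [ofN, Finsupp.single_apply, Pi.smul_apply, Pi.single_apply, smul_eq_mul]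
  by_cases h : i = j
  · subst h; simp
  · rw [if_neg (Ne.symm h), if_neg h]; simp

variable {k : Type} [Field k]

/-- THE PRODUCT FORMULA FOR SPANS OF TWO EXPONENT SETS: the monomials `x^{β + κ}` (`β ∈ B`, `κ ∈ K`) span the product of the spans of the
monomials `x^β` and `x^κ`. [folklore] -/
theorem span_image_add (B K : Set (Fin n →₀ ℕ)) :
    Ideal.span ((fun e : Fin n →₀ ℕ => (monomial e (1 : k) : MvPolynomial (Fin n) k)) '' {e | ∃ β ∈ B, ∃ κ ∈ K, e = β + κ}) =
      Ideal.span ((fun e : Fin n →₀ ℕ => (monomial e (1 : k) : MvPolynomial (Fin n) k)) '' B) *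
        Ideal.span ((fun e : Fin n →₀ ℕ => (monomial e (1 : k) : MvPolynomial (Fin n) k)) '' K) := by
  rw [Ideal.span_mul_span']
  congr 1
  ext p
  simp only [Set.mem_image, Set.mem_setOf_eq, Set.mem_mul]
  constructor
  · rintro ⟨e, ⟨β, hβ, κ, hκ, rfl⟩, rfl⟩
    exact ⟨monomial β 1, ⟨β, hβ, rfl⟩, monomial κ 1, ⟨κ, hκ, rfl⟩, by rw [monomial_mul, one_mul]⟩
  · rintro ⟨_, ⟨β, hβ, rfl⟩, _, ⟨κ, hκ, rfl⟩, rfl⟩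
    exact ⟨_, ⟨β, hβ, κ, hκ, rfl⟩, by rw [monomial_mul, one_mul]⟩

end Summit.ResolutionOfSingularities.ResolutionOfSingularities.Theorems.FInjectiveMacaulayfication.F108Toric

end
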